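import Literature.MathematicalPhysics.QuantumLattice.HubbardGaugeBound
import Literature.MathematicalPhysics.QuantumLattice.HubbardWave0LiebProofs
import HarnessLib

/-!
# The grand-canonical Hubbard Hamiltonian is Hermitian and conserves `N`: discharge

Family `hubbard` (trunk T-QLATTICE). Sibling proof file of
`Literature/MathematicalPhysics/QuantumLattice/HubbardModel.lean`: it DISCHARGES the named fact
`Literature.MathematicalPhysics.QuantumLattice.hamiltonianWith_isHermitian_and_commute`
(`def … : Prop`, D-0014) of that file — for every finite graph `G` and real `t`, `U`, `μ`, the
grand-canonical Hubbard Hamiltonian `H(t, U) - μ N` is Hermitian and commutes with the total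
particle number `N`. No statement is introduced or changed; everything is assembled from accepted
tree results:

* hermiticity is `isHermitian_hamiltonianWith` (`HubbardGaugeBound`: the hopping form over ordered
  pairs contains each monomial with its adjoint, the density terms `U Σ n↑n↓ - μ N` are sums of
  commuting Hermitian projections with real coefficients);
* `[H(t, U), N] = 0` is the second conjunct of `hamiltonian_isHermitian_and_commute_holds`
  (`HubbardWave0LiebProofs`: `H(t, U)` is block diagonal in the sectors `(N↑, N↓)` and `N` is a
  function of the sector), and `[μ N, N] = 0` trivially.

Proved here (namespace `Literature.MathematicalPhysics.QuantumLattice`):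

* `hamiltonianWith_commute_totalNumber` — `[H(t, U) - μ N, N] = 0`;
* `hamiltonianWith_isHermitian_and_commute_holds` — the discharge.

## Source

E. H. Lieb, *The Hubbard model: some rigorous results and open problems*, arXiv:cond-mat/9311033
(in *Advances in Dynamical Systems and Quantum Physics*, Capri 1993, World Scientific; also Proc.
XIth Int. Congress of Mathematical Physics, Paris 1994), §1 "Definition of the Model" [arXiv9311033]
(the section cited as "§2" in `HubbardModel.lean`, counting the introduction "§0" as the first
section): "`T` is always self adjoint, `t_{xy} = t*_{yx}`" (before eq. (1.1)), and "The total
number of each spin species `N_σ = Σ_{x ∈ Λ} n_{xσ}` is a conserved quantity. The total particle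
number is `N = N_↑ + N_↓`" (after eq. (1.1)); with `U_x` and `μ` real, `H = K + W` (eq. (1.3)) and
`H - μ N` are Hermitian and conserve `N`. Secondary: H. Tasaki, *Physics and Mathematics of
Quantum Many-Body Systems* (2020), §9.3.
-/

noncomputable section

namespace Literature.MathematicalPhysics.QuantumLattice

open Matrix Finset

section GrandCanonical

variable {Λ : Type*} [LinearOrder Λ] [Fintype Λ] (G : SimpleGraph Λ) [DecidableRel G.Adj]

/-- **Particle-number conservation of the grand-canonical Hubbard Hamiltonian**:
`[H(t, U) - μ N, N] = 0`, from `[H(t, U), N] = 0` (`hamiltonian_isHermitian_and_commute_holds`)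
and `[N, N] = 0`. Lieb, arXiv:cond-mat/9311033, §1, after eq. (1.1) ("`N_σ` is a conserved
quantity; `N = N_↑ + N_↓`"). [cite: arXiv9311033, §1 (Definition of the Model), after eq. (1.1)] -/
theorem hamiltonianWith_commute_totalNumber (t U μ : ℝ) :
    Commute (hamiltonianWith G t U μ) totalNumber := by
  rw [hamiltonianWith_eq]
  exact (hamiltonian_isHermitian_and_commute_holds G t U).2.1.sub_left
    ((Commute.refl _).smul_left _)

/-- **Discharge of `hamiltonianWith_isHermitian_and_commute`**: for every finite graph `G` and
real `t`, `U`, `μ`, the grand-canonical Hubbard Hamiltonian `H(t, U) - μ N` is Hermitian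
(`isHermitian_hamiltonianWith`) and commutes with the total particle number `N`
(`hamiltonianWith_commute_totalNumber`). Lieb, arXiv:cond-mat/9311033, §1 "Definition of the
Model": `T` self-adjoint (before eq. (1.1)), `N_σ` conserved and `N = N_↑ + N_↓` (after eq. (1.1)),
`H = K + W` (eq. (1.3)). [cite: arXiv9311033, §1 (Definition of the Model), eqs. (1.1)–(1.3)] -/
theorem hamiltonianWith_isHermitian_and_commute_holds :
    hamiltonianWith_isHermitian_and_commute G := fun t U μ =>
  ⟨isHermitian_hamiltonianWith G t U μ, hamiltonianWith_commute_totalNumber G t U μ⟩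

end GrandCanonical

end Literature.MathematicalPhysics.QuantumLattice
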